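import Mathlib
import HarnessLib
import Summits.HubbardSuperconductivity.HubbardSuperconductivity.Theorems.KLProgrammeFermiSurfaceFST3H4Prime
import Summits.HubbardSuperconductivity.HubbardSuperconductivity.Theorems.KLProgrammeFermiSurfaceDopingForm

/-!
# Route `KLProgramme` (cruxes K3/K1, risk r2): FST III Theorem 1.1 — the PREMISE LISTS of both typed variants
# `theorem11_i` / `theorem11_ii` DECIDED for the Hubbard record: variant (i) is instantiable iff `μ < -2`
# (never on a programme window), variant (ii) nowhere; and an ERRATUM to the prose of `…FermiSurfaceFST3H4Prime`

Cell `gate-hubbard-kl`, seat fs-1 (g10), risk-register item r2 «Fermi-surface hypotheses at `δ ∈ [0.10, 0.20]`».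
`FermiRG/FST3Main.lean` (typer t5) types FST III Theorem 1.1 [Feldman–Salmhofer–Trubowitz, *Regularity of
interacting nonspherical Fermi surfaces: the full self-energy*, FST III p.3] as two `d = 2` schemas with the PRINTED
hypothesis lists
* `theorem11_i K`  — variant (i), the SYMMETRIC branch: (H1)_{2,h}, (H2)_{2,h}, (H3), **(Sy)**, **(H5)**, `Admits M c`,
  `0 ≤ h < 1/2` («`h = 0` is allowed»);
* `theorem11_ii K` — variant (ii), the ASYMMETRIC branch: (H1)_{2,h}, (H2)_{2,h}, (H3), **(H4)**, **(H4′)** (`K_a`),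
  **(H5)**, `Admits M c`, `0 < h < 1/3`;
both carry the filling restriction (H5).  The fs-1 census files decided every hypothesis for a record `M` carrying
the Hubbard band `M.e = ε - μ` (`-4 < μ < 0`): (H1)–(H4), (Sy), `Admits` ✓ (`KLProgrammeFermiSurfaceFST3`),
(H5) ✓ iff `μ < -2` (`klfs_fst3_h5_iff`, cell of `Crystal.cubic 2`), (H4′) ✗ for every `K_a`
(`KLProgrammeFermiSurfaceFST3H4Prime`).  This module assembles those rows INTO THE TWO PREMISE LISTS, so that the
instantiability of each variant is a theorem and not prose:

* §1 `klfs_fst3_theorem11_i_premises_iff`: at `h = 0`, (H1)(H2)(H3)(Sy)(H5) hold **iff `μ < -2`**;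
  `klfs_fst3_theorem11_ii_premises_false`: the list of (ii) is unsatisfiable at EVERY `-4 < μ < 0`, every `h`,
  every `K_a` (it contains (H4′));
* §2 `klfs_fst3_theorem11_i_hubbard`: for `-8/3 < μ < -2` (FST II's «`n < 0.369`», BGM 2006's regime included)
  variant (i) IS instantiable — conditionally on the typed fact `theorem11_i K`, every `K_r(M)`, `r ≥ 1`, is
  `Γ`-periodic, `C²`, with `|K_r|₂ ≤ 𝓒₁^r r!`;
* §3 on the programme windows (doping window of record `[-0.4275, -0.1775]` ⊃ `μ([0.10, 0.20])`, analysis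
  `[-1, -0.15]`, extended `[-0.5725, -0.075]`, `klWindowC = [-1.05, -0.15]`) BOTH lists are unsatisfiable —
  (i) fails EXACTLY at (H5), (ii) at (H4′) and (H5) — while (H1)(H2)(H3)(Sy)(H4) hold
  (`klfs_windows_fst3_theorem11_premises`); the `δ`-form for `δ ∈ [0.10, 0.20]` (`klfs_doping_fst3_theorem11_premises`,
  via margin-2's `muOfDoping_mem_window_d010_d020`).  What IS instantiable on the windows is Theorem 1.2 (`theorem12`,
  no (H5)): `klfs_fst3_theorem12_hubbard` (`KLProgrammeFermiSurfaceFST3` §5).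

ERRATUM (prose only; no theorem statement anywhere is affected).  The module docstring of
`KLProgrammeFermiSurfaceFST3H4Prime` (l.11, l.25–26) and the docstrings of `klfs_fst3_census_h4'` /
`klfs_windows_fst3_not_h4'` there say «(H4′) — the extra hypothesis of FST III Theorem 1.1 (i)» and «consumers take
Theorem 1.1 (ii) (symmetric `e`)».  The labels are INVERTED with respect to the print and to `FST3Main`: (H4′) belongs
to variant **(ii)** (asymmetric), (Sy) to variant **(i)**; (H5) to BOTH.  Correct reading, as proved below: NEITHER
variant of Theorem 1.1 has an instance for the Hubbard band on any programme window ((H5) fails on all of them;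
(ii) fails in addition at (H4′) for every `K_a` and every `μ`); variant (i) applies to the Hubbard band exactly in
the regime `μ < -2`; Theorem 1.2 applies at every `-4 < μ < 0`.  HOME/FS-WINDOW.md §13 records the same erratum.
No definitions; everything PROVED; no record `M` is built (W-004). [folklore]
-/

noncomputable section

open Real Set

-- the tree's namespace `Summit.<Summit>.<Problem>.Theorems` repeats the summit name by design (D-0017)
set_option linter.dupNamespace false

namespace Summit.HubbardSuperconductivity.HubbardSuperconductivity.Theorems

open Literature.MathematicalPhysics.QuantumLattice

/-! ### §1 The two premise lists at a general level `-4 < μ < 0` -/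

/-- **Variant (i)'s Fermi-surface premises hold iff `μ < -2`.**  For a record carrying the Hubbard band and the
on-site interaction with the cell of `Crystal.cubic 2`, at Hölder exponent `h = 0` («allowed» in (i)):
(H1)_{2,0} ∧ (H2)_{2,0} ∧ (H3) ∧ (Sy) ∧ (H5) `↔ μ < -2` — (H1)–(H3), (Sy) hold at every `-4 < μ < 0` and (H5) is
the filling restriction `μ < -2` (`klfs_fst3_h5_iff`). [folklore] -/
theorem klfs_fst3_theorem11_i_premises_iff {μ : ℝ} (hμ₁ : -4 < μ) (hμ₂ : μ < 0) (M : FermiRG.FST3.Model 2)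
    (he : M.e = fun p : Momentum => squareDispersion 1 0 p - μ) {U : ℝ} (hv : M.vhat = fun _ => (U : ℂ))
    (hF : M.fund = (FermiRG.Crystal.cubic 2).fundamentalDomain) :
    (FermiRG.FST3.H1 2 0 M ∧ FermiRG.FST3.H2 2 0 M ∧ FermiRG.FST3.H3 M ∧ FermiRG.FST3.Sy M ∧
      FermiRG.FST3.H5 M) ↔ μ < -2 := by
  have h5 := klfs_fst3_h5_iff hμ₁.le hμ₂ M he hF
  refine ⟨fun h => h5.1 h.2.2.2.2, fun hμ => ?_⟩
  exact ⟨klfs_fst3_h1 M hv 2 0, klfs_fst3_h2 hμ₁ hμ₂ M he 2, klfs_fst3_h3 hμ₁ hμ₂ M he,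
    klfs_fst3_sy M he, h5.2 hμ⟩

/-- **Variant (ii)'s premise list is unsatisfiable for the Hubbard record at every `-4 < μ < 0`**, every Hölder
exponent `h` and every `K_a`: it contains (H4′), which fails in every angular chart (`klfs_fst3_not_h4'`:
`∂a/∂θ ≡ 1`).  No cell hypothesis is needed. [folklore] -/
theorem klfs_fst3_theorem11_ii_premises_false {μ : ℝ} (hμ₁ : -4 < μ) (hμ₂ : μ < 0) (M : FermiRG.FST3.Model 2)
    (he : M.e = fun p : Momentum => squareDispersion 1 0 p - μ) (h Ka : ℝ) :
    ¬ (FermiRG.FST3.H1 2 h M ∧ FermiRG.FST3.H2 2 h M ∧ FermiRG.FST3.H3 M ∧ FermiRG.FST3.H4 M ∧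
        FermiRG.FST3.H4' M Ka ∧ FermiRG.FST3.H5 M) :=
  fun hyp => klfs_fst3_not_h4' hμ₁ hμ₂ M he Ka hyp.2.2.2.2.1

/-- **Above `μ = -2` variant (i)'s list is unsatisfiable too** (every `h`): (H5) fails for `-2 ≤ μ < 0` with the
cell of `Crystal.cubic 2`. [folklore] -/
theorem klfs_fst3_theorem11_i_premises_false {μ : ℝ} (hμ₁ : -2 ≤ μ) (hμ₂ : μ < 0) (M : FermiRG.FST3.Model 2)
    (he : M.e = fun p : Momentum => squareDispersion 1 0 p - μ)
    (hF : M.fund = (FermiRG.Crystal.cubic 2).fundamentalDomain) (h : ℝ) :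
    ¬ (FermiRG.FST3.H1 2 h M ∧ FermiRG.FST3.H2 2 h M ∧ FermiRG.FST3.H3 M ∧ FermiRG.FST3.Sy M ∧
        FermiRG.FST3.H5 M) :=
  fun hyp => absurd ((klfs_fst3_h5_iff (by linarith) hμ₂ M he hF).1 hyp.2.2.2.2) (not_lt.2 hμ₁)

/-! ### §2 Variant (i) IS instantiable in the regime `μ < -2` (conditional on the typed fact) -/

/-- **FST III Theorem 1.1 (i) for the Hubbard band below `μ = -2`, CONDITIONAL on the typed fact**: if
`FST3.theorem11_i K` holds for a counterterm binder `K` (FST I's coefficients; GAP G-t5-1), then for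
`-8/3 < μ < -2` and every record `M` carrying the Hubbard band, the on-site interaction and the cell of
`Crystal.cubic 2`, there is `𝓒₁` with: every `K_r(M)`, `r ≥ 1`, is `Γ`-periodic, `C²` (`h = 0`), and
`|K_r|₂ ≤ 𝓒₁^r r!`.  The regularity datum is `⟨0, 9(4+|μ|), |U|, g₀, -μ/2, -μ/4⟩` with
`g₀ = √((-μ/2)(4+3μ/2))/2` (`klfs_fst3_admits`); (H5) from `μ < -2`.  Nothing is asserted about `K`. [folklore] -/
theorem klfs_fst3_theorem11_i_hubbard {K : FermiRG.FST3.Counterterm 2} (hT : FermiRG.FST3.theorem11_i K)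
    {μ : ℝ} (hμ₁ : -8 / 3 < μ) (hμ₂ : μ < -2) (M : FermiRG.FST3.Model 2)
    (he : M.e = fun p : Momentum => squareDispersion 1 0 p - μ) {U : ℝ} (hv : M.vhat = fun _ => (U : ℂ))
    (hF : M.fund = (FermiRG.Crystal.cubic 2).fundamentalDomain) :
    ∃ C₁ : ℝ, ∀ r : ℕ, 1 ≤ r →
      M.OnTorus (K M r) ∧ FermiRG.FST3.IsCkHolder 2 0 (K M r) ∧
        FermiRG.FST3.CkHolderNormLE 2 0 (K M r) (C₁ ^ r * (r.factorial : ℝ)) := by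
  have hμ0 : μ < 0 := by linarith
  have hμ4 : -4 < μ := by linarith
  -- the regularity datum admitted by the record
  set g := Real.sqrt (-μ / 2 * (4 + 3 * μ / 2)) with hg
  have hgpos : 0 < g := by
    rw [hg]; apply Real.sqrt_pos.2; nlinarith
  have hAd : FermiRG.FST3.Admits M ⟨0, 9 * (4 + |μ|), |U|, g / 2, -μ / 2, -μ / 4⟩ :=
    klfs_fst3_admits hμ₁ hμ0 M he hv le_rfl le_rfl (by linarith) le_rfl (by positivity) (by linarith)
      (by linarith) le_rfl
  obtain ⟨C₁, hC₁⟩ := hT ⟨0, 9 * (4 + |μ|), |U|, g / 2, -μ / 2, -μ / 4⟩ le_rfl (by norm_num)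
  refine ⟨C₁, fun r hr => ?_⟩
  exact hC₁ M (klfs_fst3_h1 M hv 2 0) (klfs_fst3_h2 hμ4 hμ0 M he 2) (klfs_fst3_h3 hμ4 hμ0 M he)
    (klfs_fst3_sy M he) ((klfs_fst3_h5_iff hμ4.le hμ0 M he hF).2 hμ₂) hAd r hr

/-! ### §3 On the programme windows: both lists unsatisfiable; what holds instead -/

/-- **On the programme's four windows NEITHER variant of FST III Theorem 1.1 has an instance for the Hubbard
record** (cell of `Crystal.cubic 2`, on-site `v̂ ≡ U`): variant (i)'s list fails — EXACTLY at (H5), since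
(H1)_{2,0} (H2)_{2,0} (H3) (Sy) (H4) all hold — and variant (ii)'s list fails (at (H4′) for every `K_a`, and at
(H5)), for every Hölder exponent `h`.  Consumers on the windows take Theorem 1.2 (`klfs_fst3_theorem12_hubbard`).
[folklore] -/
theorem klfs_windows_fst3_theorem11_premises {μ : ℝ}
    (hμ : μ ∈ Icc (-0.4275 : ℝ) (-0.1775) ∨ μ ∈ Icc (-1 : ℝ) (-0.15) ∨ μ ∈ Icc (-0.5725 : ℝ) (-0.075) ∨
      μ ∈ Icc (-1.05 : ℝ) (-0.15))
    (M : FermiRG.FST3.Model 2) (he : M.e = fun p : Momentum => squareDispersion 1 0 p - μ) {U : ℝ}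
    (hv : M.vhat = fun _ => (U : ℂ)) (hF : M.fund = (FermiRG.Crystal.cubic 2).fundamentalDomain) :
    (∀ h : ℝ, ¬ (FermiRG.FST3.H1 2 h M ∧ FermiRG.FST3.H2 2 h M ∧ FermiRG.FST3.H3 M ∧ FermiRG.FST3.Sy M ∧
        FermiRG.FST3.H5 M)) ∧
    (∀ h Ka : ℝ, ¬ (FermiRG.FST3.H1 2 h M ∧ FermiRG.FST3.H2 2 h M ∧ FermiRG.FST3.H3 M ∧ FermiRG.FST3.H4 M ∧
        FermiRG.FST3.H4' M Ka ∧ FermiRG.FST3.H5 M)) ∧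
    (FermiRG.FST3.H1 2 0 M ∧ FermiRG.FST3.H2 2 0 M ∧ FermiRG.FST3.H3 M ∧ FermiRG.FST3.Sy M ∧
      FermiRG.FST3.H4 M) ∧ ¬ FermiRG.FST3.H5 M := by
  have hμ₁ : -2 ≤ μ := by rcases hμ with h | h | h | h <;> linarith [h.1]
  have hμ₂ : μ < 0 := by rcases hμ with h | h | h | h <;> linarith [h.2]
  have hμ4 : -4 < μ := by linarith
  refine ⟨fun h => klfs_fst3_theorem11_i_premises_false hμ₁ hμ₂ M he hF h,
    fun h Ka => klfs_fst3_theorem11_ii_premises_false hμ4 hμ₂ M he h Ka,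
    ⟨klfs_fst3_h1 M hv 2 0, klfs_fst3_h2 hμ4 hμ₂ M he 2, klfs_fst3_h3 hμ4 hμ₂ M he, klfs_fst3_sy M he,
      klfs_fst3_h4 hμ4 hμ₂ M he⟩,
    (klfs_windows_fst3_not_h4' hμ M he hF).2⟩

/-- **`δ`-form on the doping window of record**: for every `δ ∈ [0.10, 0.20]`, at the free-band chemical potential
`μ(δ) = chemicalPotentialOfDensity ε₀ (1 - δ)` (margin-2's certified link `muOfDoping_mem_window_d010_d020`
⇒ `μ(δ) ∈ [-0.4275, -0.1775]`), neither premise list of FST III Theorem 1.1 is satisfiable for the Hubbard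
record, while (H1)_{2,0} (H2)_{2,0} (H3) (Sy) (H4) hold and (H5) fails. [folklore] -/
theorem klfs_doping_fst3_theorem11_premises {δ : ℝ} (hδ : δ ∈ Icc (0.10 : ℝ) 0.20)
    (M : FermiRG.FST3.Model 2)
    (he : M.e = fun p : Momentum =>
      squareDispersion 1 0 p - chemicalPotentialOfDensity (squareDispersion 1 0) (1 - δ))
    {U : ℝ} (hv : M.vhat = fun _ => (U : ℂ)) (hF : M.fund = (FermiRG.Crystal.cubic 2).fundamentalDomain) :
    (∀ h : ℝ, ¬ (FermiRG.FST3.H1 2 h M ∧ FermiRG.FST3.H2 2 h M ∧ FermiRG.FST3.H3 M ∧ FermiRG.FST3.Sy M ∧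
        FermiRG.FST3.H5 M)) ∧
    (∀ h Ka : ℝ, ¬ (FermiRG.FST3.H1 2 h M ∧ FermiRG.FST3.H2 2 h M ∧ FermiRG.FST3.H3 M ∧ FermiRG.FST3.H4 M ∧
        FermiRG.FST3.H4' M Ka ∧ FermiRG.FST3.H5 M)) ∧
    (FermiRG.FST3.H1 2 0 M ∧ FermiRG.FST3.H2 2 0 M ∧ FermiRG.FST3.H3 M ∧ FermiRG.FST3.Sy M ∧
      FermiRG.FST3.H4 M) ∧ ¬ FermiRG.FST3.H5 M :=
  klfs_windows_fst3_theorem11_premises (Or.inl (klfs_muOfDoping_mem_dwin hδ)) M he hv hF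

end Summit.HubbardSuperconductivity.HubbardSuperconductivity.Theorems

end
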